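import Summits.ResolutionOfSingularities.ResolutionOfSingularities.Theorems.PurelyInseparableDim4SwapTransportReadTwo
import Summits.ResolutionOfSingularities.ResolutionOfSingularities.Theorems.PurelyInseparableDim4ResConeRechartWeights
import Literature.Barriers.ResolutionOfSingularities.KangarooShadeIncrease
import HarnessLib
import HarnessLib.Audit.Tags

/-!
# Purely inseparable four-folds — READINGS through a ONE-SLOT slot-unit-class frame (three free letters): invertible
# tangent, isolation and `ord₀` transfer, Cramer `3 × 3`, and the order-generic step bookkeeping (cell `res-dim4-pi`,
# K2(p) lane, slice C; hN4-D transport list items V3 + V4; free kernel hand res-dim4-p-8 g5)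

[OURS · counted 0 · cell `res-dim4-pi` · K2(p) lane (holder res-dim4-p-12 g4); items V3/V4 of res-dim4-typ-1 g3's
`HN4D-DESIGN.md` §5 «TRANSPORT VARIANTS NEEDED for D∞» (2026-08-29 07:23Z), taken by res-dim4-p-8 g5 as a free hand
(bus 07:25Z) so that res-dim4-typ-1 g4 starts at V2/V1; template = res-dim4-typ-1 g3's `…SwapTransportReadTwo` (two slots).]
Nothing here proves hN4-D, K2(5) (`RidgeBudget.NoAboveFloorTrap 5 5`), `NoIsolatedTrap 5 5` or resolution of singularities in
dimension ≥ 4 / characteristic `p` — NOT proved, not here, not anywhere in this programme.  AI kernel work, weaker than expert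
review.

WHY.  A `(2)`-state of the D∞ `(5,4)` class (W₄ `four_weights_dichotomy`) has ONE boundary letter (weight `2`) and THREE free
letters, so the virtual / re-presented frames there are of slot-unit class with ONE slot: `θ(x_{π a}) = x_a · e_a` (`e_a(0) ≠ 0`)
and three origin-preserving images `θ(x_{π u}), θ(x_{π f}), θ(x_{π g})`.  This file is the one-slot edition of the two-slot
readings file:

* §1 `slotUnitClass_origin₁` — such a `θ` fixes the origin; **`isUnit_det_slotUnitClass₁`** — its tangent matrix is, after the row
  permutation `π` and the reindexing `(slot | free letters) : Fin 1 ⊕ Fin 3 ≃ Fin 4`, block lower-triangular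
  `[[e_a(0), 0], [∗, F₃]]`, hence a unit as soon as the `3 × 3` FREE BLOCK `F₃ = (∂θ_{π i}/∂x_k (0))_{i,k ∈ {u,f,g}}` has
  non-zero determinant;
* §2 **`read_of_rel₁`** — J1 (`JetInverse.exists_approx_inverse`) + SN2 (`SwapNorm.isIsolated_of_rel` / `ordZero_of_rel`):
  a state related to an isolated state by a one-slot frame at a level `M` past the isolation certificate is ISOLATED with the
  same `ord₀` (`p ∤ ord₀ < M`) — any prime `p`, any order;
* §3 `exists_solve_three` — Cramer on a `3 × 3` block (`Matrix.mulVec` of the adjugate solution), and the supported form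
  `exists_solve_three_supported` (a translation supported on `{u, f, g}` with prescribed free-block image) for the virtual
  translations of V1/V2;
* §4 (V3, order-generic bookkeeping) `step_r_apply_gen` — `(step q univ j b A).r i = if i = j then o − q else if b i = 0 then
  A.r i else 0` for `ord₀ A.F = o` (res-dim4-p-7's `SwapNorm.step_r_apply`; the `o = 6` instance is res-dim4-typ-1's
  `step_r_apply_six`), and `forall_le_step_gen` — `x^{r′} ∣ F′` after ANY point step with `b j = 0` from `x^r ∣ F`, no order
  hypothesis (the tree's `CentreBlowup.newMult_le_of_mem_support_step` at `univ`; the `o = 6` instance is `forall_le_step_six`,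
  the `Step0` form `IsolatedMultiplicity.forall_le_step_of_step0`).

[cite: Hauser2010, §§F–G (blowup, transform D′, coordinate changes)] [cite: CossartJannsenSaito2020, Thm. 3.14]
bears_on: LADDER-RESOLUTION:D157-DOOR2 (res-dim4-pi · K2(p) · slice C · hN4-D transport V3/V4).  Supports
stmt-ResolutionOfSingularities-16155 (helper).
-/

set_option linter.dupNamespace false -- mandated namespace of this single-conjunct summit

noncomputable section

namespace Summit.ResolutionOfSingularities.ResolutionOfSingularities.Theorems.PIDim4

namespace SwapTransport

open MvPolynomial Finset
open Literature.AlgebraicGeometry.Resolution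
open Literature.AlgebraicGeometry.Resolution.CentreBlowup
open Literature.AlgebraicGeometry.Resolution.Hauser2010

variable {K : Type} [Field K]

/-! ## §1 The tangent map of a one-slot slot-unit-class substitution -/

/-- A one-slot slot-unit-class substitution (slot `a`, free letters `u, f, g`) fixes the origin. [folklore] -/
theorem slotUnitClass_origin₁ {π : Equiv.Perm (Fin 4)} {a u f g : Fin 4} (hau : a ≠ u) (haf : a ≠ f) (hag : a ≠ g)
    (huf : u ≠ f) (hug : u ≠ g) (hfg : f ≠ g) {θ : Fin 4 → MvPolynomial (Fin 4) K} {ea : MvPolynomial (Fin 4) K}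
    (hθa : θ (π a) = X a * ea) (hu0 : constantCoeff (θ (π u)) = 0) (hf0 : constantCoeff (θ (π f)) = 0)
    (hg0 : constantCoeff (θ (π g)) = 0) : ∀ k, constantCoeff (θ k) = 0 := by
  intro k
  obtain ⟨i, rfl⟩ := π.surjective k
  rcases letters4 hau haf hag huf hug hfg i with h | h | h | h <;> rw [h]
  · rw [hθa, map_mul, constantCoeff_X, zero_mul]
  · exact hu0
  · exact hf0
  · exact hg0

/-- The reindexing `(slot | free letters) : Fin 1 ⊕ Fin 3 ≃ Fin 4` for four distinct letters. [folklore] -/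
theorem blockIndex_bijective₁ {a u f g : Fin 4} (hau : a ≠ u) (haf : a ≠ f) (hag : a ≠ g) (huf : u ≠ f) (hug : u ≠ g)
    (hfg : f ≠ g) : Function.Bijective (Sum.elim ![a] ![u, f, g] : Fin 1 ⊕ Fin 3 → Fin 4) := by
  rw [Fintype.bijective_iff_injective_and_card]
  refine ⟨?_, by simp⟩
  rintro (i | i) (j | j) h <;> fin_cases i <;> fin_cases j <;>
    simp_all [hau.symm, haf.symm, hag.symm, huf.symm, hug.symm, hfg.symm]

/-- **THE TANGENT MAP OF A ONE-SLOT SLOT-UNIT-CLASS SUBSTITUTION IS INVERTIBLE iff its free block is**: with the slot `a`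
(image `x_a · e_a`, `e_a(0) ≠ 0`) and free letters `u, f, g`, `det (∂θ_i/∂x_k (0))` is a unit as soon as the `3 × 3` block of
the linear coefficients of `θ(x_{π u}), θ(x_{π f}), θ(x_{π g})` at `x_u, x_f, x_g` has non-zero determinant. [folklore] -/
theorem isUnit_det_slotUnitClass₁ {π : Equiv.Perm (Fin 4)} {a u f g : Fin 4} (hau : a ≠ u) (haf : a ≠ f) (hag : a ≠ g)
    (huf : u ≠ f) (hug : u ≠ g) (hfg : f ≠ g) {θ : Fin 4 → MvPolynomial (Fin 4) K} {ea : MvPolynomial (Fin 4) K}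
    (hθa : θ (π a) = X a * ea) (hea : constantCoeff ea ≠ 0)
    (hdet : (Matrix.of fun i k : Fin 3 =>
      coeff (Finsupp.single ((![u, f, g] : Fin 3 → Fin 4) k) 1) (θ (π ((![u, f, g] : Fin 3 → Fin 4) i)))).det ≠ 0) :
    IsUnit (Matrix.det (Matrix.of fun i k => coeff (Finsupp.single k 1) (θ i))) := by
  classical
  set L : Matrix (Fin 4) (Fin 4) K := Matrix.of fun i k => coeff (Finsupp.single k 1) (θ i) with hL
  -- rows re-indexed by `π`
  set T : Matrix (Fin 4) (Fin 4) K := L.submatrix π id with hT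
  have hTik : ∀ i k, T i k = coeff (Finsupp.single k 1) (θ (π i)) := fun i k => rfl
  -- the block reindexing `(a | u, f, g)`
  set σ : Fin 1 ⊕ Fin 3 ≃ Fin 4 := Equiv.ofBijective _ (blockIndex_bijective₁ hau haf hag huf hug hfg) with hσ
  have hσl0 : σ (Sum.inl 0) = a := rfl
  have hσr : ∀ i : Fin 3, σ (Sum.inr i) = (![u, f, g] : Fin 3 → Fin 4) i := fun i => rfl
  set A : Matrix (Fin 1) (Fin 1) K := Matrix.of fun i j => T (σ (Sum.inl i)) (σ (Sum.inl j)) with hA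
  set C : Matrix (Fin 3) (Fin 1) K := Matrix.of fun i j => T (σ (Sum.inr i)) (σ (Sum.inl j)) with hC
  set D : Matrix (Fin 3) (Fin 3) K := Matrix.of fun i j => T (σ (Sum.inr i)) (σ (Sum.inr j)) with hD
  -- the slot row has no free entries: the upper-right block vanishes
  have hslot : ∀ k : Fin 4, k ≠ a → coeff (Finsupp.single k 1) (θ (π a)) = 0 := by
    intro k hka
    rw [hθa, SwapNorm.coeff_single_X_mul_eq, if_neg hka]
  have hfree_ne : ∀ j : Fin 3, (![u, f, g] : Fin 3 → Fin 4) j ≠ a := by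
    intro j
    fin_cases j
    · exact hau.symm
    · exact haf.symm
    · exact hag.symm
  have hblocks : T.submatrix σ σ = Matrix.fromBlocks A 0 C D := by
    ext (i | i) (j | j)
    · rfl
    · rw [Matrix.submatrix_apply, Matrix.fromBlocks_apply₁₂, Matrix.zero_apply, hTik]
      fin_cases i
      exact hslot _ (hfree_ne j)
    · rfl
    · rfl
  have hdetA : A.det = constantCoeff ea := by
    rw [Matrix.det_fin_one]
    simp only [hA, Matrix.of_apply, hTik, hσl0]
    rw [hθa, SwapNorm.coeff_single_X_mul_eq, if_pos rfl]
  have hdetD : D.det = (Matrix.of fun i k : Fin 3 =>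
      coeff (Finsupp.single ((![u, f, g] : Fin 3 → Fin 4) k) 1) (θ (π ((![u, f, g] : Fin 3 → Fin 4) i)))).det := by
    rfl
  have hdetT : T.det = constantCoeff ea * (Matrix.of fun i k : Fin 3 =>
      coeff (Finsupp.single ((![u, f, g] : Fin 3 → Fin 4) k) 1) (θ (π ((![u, f, g] : Fin 3 → Fin 4) i)))).det := by
    rw [← Matrix.det_submatrix_equiv_self σ T, hblocks, Matrix.det_fromBlocks_zero₁₂, hdetA, hdetD]
  -- back to `L` through the row permutation
  have hLdet : L.det = Equiv.Perm.sign π * T.det := by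
    have h := Matrix.det_permute π L
    have hs : ((Equiv.Perm.sign π : ℤ) : K) * ((Equiv.Perm.sign π : ℤ) : K) = 1 := by
      rw [← Int.cast_mul, ← Units.val_mul, Int.units_mul_self, Units.val_one, Int.cast_one]
    calc L.det = ((Equiv.Perm.sign π : ℤ) : K) * (((Equiv.Perm.sign π : ℤ) : K) * L.det) := by
          rw [← mul_assoc, hs, one_mul]
      _ = _ := by rw [← h]
  rw [hLdet, hdetT]
  refine isUnit_iff_ne_zero.mpr (mul_ne_zero ?_ (mul_ne_zero hea hdet))
  rcases Int.units_eq_one_or (Equiv.Perm.sign π) with h | h <;> rw [h] <;> simp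

/-! ## §2 Readings of a re-presented state through a one-slot frame -/

section Read

variable (p : ℕ) [hp : Fact p.Prime] [CharP K p]

/-- **ISOLATION AND `ord₀` PASS THROUGH A ONE-SLOT SLOT-UNIT-CLASS FRAME** (`read_of_rel₁`): if
`FB = clean(Uᵖ·θ(FA)) + E`, `E ∈ 𝔪₀ᴹ`, `θ` of one-slot slot-unit class along `π` (slot `a`, free `u, f, g`) with invertible
`3 × 3` free block, and `FA` is isolated with certificate level `N` (`N + p + 1 ≤ M`) and `ord₀ FA = o`, `p ∤ o`, `o < M`, then
`FB` is isolated and `ord₀ FB = o`. [OURS] [cite: Hauser2010, §§F–G] -/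
theorem read_of_rel₁ {π : Equiv.Perm (Fin 4)} {a u f g : Fin 4} (hau : a ≠ u) (haf : a ≠ f) (hag : a ≠ g)
    (huf : u ≠ f) (hug : u ≠ g) (hfg : f ≠ g) {M N o : ℕ} {FA FB : MvPolynomial (Fin 4) K}
    {θ : Fin 4 → MvPolynomial (Fin 4) K} {ea U E : MvPolynomial (Fin 4) K}
    (hθa : θ (π a) = X a * ea) (hea : constantCoeff ea ≠ 0) (hu0 : constantCoeff (θ (π u)) = 0)
    (hf0 : constantCoeff (θ (π f)) = 0) (hg0 : constantCoeff (θ (π g)) = 0)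
    (hdet : (Matrix.of fun i k : Fin 3 =>
      coeff (Finsupp.single ((![u, f, g] : Fin 3 → Fin 4) k) 1) (θ (π ((![u, f, g] : Fin 3 → Fin 4) i)))).det ≠ 0)
    (hU : constantCoeff U ≠ 0) (hE : E ∈ originIdeal K ^ M) (hrel : FB = deletePthPowers p (U ^ p * aeval θ FA) + E)
    (hiso : IsIsolated p FA) (hN : originIdeal K ^ N ≤ singLocusIdeal p FA ⊔ originIdeal K ^ (N + 1))
    (hM : N + p + 1 ≤ M) (ho : ordZero FA = o) (hpo : ¬ p ∣ o) (hoM : o < M) :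
    IsIsolated p FB ∧ ordZero FB = o := by
  have hθ0 := slotUnitClass_origin₁ hau haf hag huf hug hfg hθa hu0 hf0 hg0
  obtain ⟨θ', hθ'0, hθθ', hθ'θ⟩ := JetInverse.exists_approx_inverse θ hθ0
    (isUnit_det_slotUnitClass₁ hau haf hag huf hug hfg hθa hea hdet) M
  exact ⟨SwapNorm.isIsolated_of_rel p hθ0 hθ'0 hθθ' hθ'θ hU hE hrel hiso.1 hN hM,
    SwapNorm.ordZero_of_rel p hθ0 hθ'0 hθ'θ hU hE hrel ho hpo hoM⟩

end Read

/-! ## §3 Solving three 1-jet relations (Cramer on the free `3 × 3` block) -/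

/-- **Cramer for a `3 × 3` block**: a square system with non-zero determinant is solvable. [folklore] -/
theorem exists_solve_three {A : Matrix (Fin 3) (Fin 3) K} (hdet : A.det ≠ 0) (r : Fin 3 → K) :
    ∃ x : Fin 3 → K, ∀ i, ∑ k, A i k * x k = r i := by
  classical
  have hA : IsUnit A.det := isUnit_iff_ne_zero.mpr hdet
  refine ⟨A⁻¹.mulVec r, fun i => ?_⟩
  have h := congrFun (Matrix.mulVec_mulVec r A A⁻¹) i
  rw [Matrix.mul_nonsing_inv A hA, Matrix.one_mulVec] at h
  rw [← h]
  rfl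

/-- **The supported form**: with free letters `u, f, g` (pairwise distinct) and an invertible `3 × 3` block `A` indexed by them,
for every right-hand side `r` there is a translation `b′ : Fin 4 → K` supported on `{u, f, g}` (`b′ i = 0` off them) with
`Σ_k A i k · b′(free k) = r i` — the shape in which V1/V2 ask for their virtual translations. [folklore] -/
theorem exists_solve_three_supported {u f g : Fin 4} (huf : u ≠ f) (hug : u ≠ g) (hfg : f ≠ g)
    {A : Matrix (Fin 3) (Fin 3) K} (hdet : A.det ≠ 0) (r : Fin 3 → K) :
    ∃ b' : Fin 4 → K, (∀ i, i ≠ u → i ≠ f → i ≠ g → b' i = 0) ∧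
      ∀ i, ∑ k, A i k * b' ((![u, f, g] : Fin 3 → Fin 4) k) = r i := by
  obtain ⟨x, hx⟩ := exists_solve_three hdet r
  obtain ⟨b', hb'⟩ : ∃ b' : Fin 4 → K,
      b' = fun i => if i = u then x 0 else if i = f then x 1 else if i = g then x 2 else 0 := ⟨_, rfl⟩
  have hbu : b' u = x 0 := by rw [hb']; dsimp only; rw [if_pos rfl]
  have hbf : b' f = x 1 := by rw [hb']; dsimp only; rw [if_neg huf.symm, if_pos rfl]
  have hbg : b' g = x 2 := by rw [hb']; dsimp only; rw [if_neg hug.symm, if_neg hfg.symm, if_pos rfl]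
  refine ⟨b', fun i hiu hif hig => ?_, fun i => ?_⟩
  · rw [hb']; dsimp only; rw [if_neg hiu, if_neg hif, if_neg hig]
  · rw [← hx i, Fin.sum_univ_three, Fin.sum_univ_three]
    simp only [Matrix.cons_val_zero, Matrix.cons_val_one, Matrix.cons_val]
    rw [hbu, hbf, hbg]

/-! ## §4 Order-generic bookkeeping of a point step (V3) -/

section Step

variable [DecidableEq K]

/-- **The weights of the child, letter by letter, at any order** (V3): the chart letter gets `o − q`, a translated letter `0`, the
others keep their weight (res-dim4-p-7's `SwapNorm.step_r_apply` with `ord_{univ} = ord₀ = o`). [cite: Hauser2010, §F (transform D′)] -/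
theorem step_r_apply_gen (q : ℕ) {A : State K} {o : ℕ} (ho : ordZero A.F = o) (jr : Fin 4) (b : Fin 4 → K) (i : Fin 4) :
    (CentreBlowup.step q Finset.univ jr b A).r i = if i = jr then o - q else if b i = 0 then A.r i else 0 := by
  rw [SwapNorm.step_r_apply, ordAlong_univ, ho]
  rfl

/-- **`x^r ∣ F` survives ANY point step** (translation vanishing on the chart letter), with no hypothesis on the order:
the tree's `CentreBlowup.newMult_le_of_mem_support_step` at the point centre, where Moh-permissibility is automatic; for
`F = 0` the child is `0` and the claim is empty. [folklore] [cite: Hauser2010, §F (transform D′)] -/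
theorem forall_le_step_gen {q : ℕ} (A : State K) (hdiv : ∀ d ∈ A.F.support, A.r ≤ d) (j : Fin 4) {b : Fin 4 → K}
    (hbj : b j = 0) :
    ∀ d ∈ (CentreBlowup.step q Finset.univ j b A).F.support, (CentreBlowup.step q Finset.univ j b A).r ≤ d := by
  classical
  by_cases hF : A.F = 0
  · intro d hd
    exfalso
    have h0 : (CentreBlowup.step q Finset.univ j b A).F = 0 := by
      show deletePthPowers q (PointBlowup.translate b (chartTransform q Finset.univ j A.F)) = 0
      unfold chartTransform PointBlowup.translate
      rw [hF, MvPolynomial.support_zero, Finset.sum_empty, map_zero, deletePthPowers_zero]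
    rw [h0, MvPolynomial.support_zero] at hd
    exact Finset.notMem_empty d hd
  have hne : ordZero A.F ≠ ⊤ := by
    unfold ordZero
    rw [Ne, MvPowerSeries.order_eq_top_iff, MvPolynomial.coe_eq_zero_iff]
    exact hF
  obtain ⟨o, ho'⟩ := WithTop.ne_top_iff_exists.mp hne
  have ho : ordZero A.F = o := ho'.symm
  refine newMult_le_of_mem_support_step q Finset.univ j b hbj A ho hdiv fun d hd => ?_
  rw [degIn_univ, degIn_univ]
  have hod : o ≤ d.degree := by
    have := Literature.Barriers.ResolutionOfSingularities.ordZero_le_of_coeff_ne_zero _ _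
      (MvPolynomial.mem_support_iff.mp hd)
    rw [ho] at this
    exact_mod_cast this
  have hrd : A.r.degree ≤ d.degree := PointBlowup.degree_le_degree_of_le (hdiv d hd)
  omega

end Step

end SwapTransport

end Summit.ResolutionOfSingularities.ResolutionOfSingularities.Theorems.PIDim4

end
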